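import Literature.MathematicalPhysics.QuantumFieldTheory.Balaban1983to89.B8Eq191FlatLettersDentedCubeMemberRec
import Literature.MathematicalPhysics.QuantumFieldTheory.Balaban1983to89.B8Ineq159FlatCubeMemberPerCube

/-!
# `Balaban1983to89.B8Prop6DentedCubeMemberNormsPointwiseRec` — [Balaban1985RegularSpaces] p. 86 «|A|_(α) = sup_j sup_{Ω_j} (Lʲη)^{−α}|A|» READ POINTWISE ON THE DENTED
# RECORD TOWER `{Ω′_j}` of [Balaban1985Variational] (148)–(150): the crown's p. 86 norm bounds (`GaugedBoundB8DZ` clause 9, the gradient member of (152)) give print's pointwise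
# form `‖F‖ ≤ C·(Lʲη)^{α}` on every bond side-touching `Ω′_j` — the boundedness side condition of the real `iSup` discharged by FINITENESS of the dented tower

statement-level skeleton of published theorems with citation tags; proofs where landed; nothing here is a claim about the Yang–Mills mass gap

CITATION HEADER (lean-in-tree rule).  Cell `pub-ymgap` (HUMAN RULING D-0062), «N05-REC» road; dag-n07-e g30's ASK (b) (bus 2026-08-29T19:18:56Z: «confirm member 2 [of [15] (152), the
gradient `∇^η A`] is in reach of the R8 knit — push-down of `msup L c.k η (−2)` like member 1's»); pen dag-n05-e g41.  [6] = [Balaban1985RegularSpaces] p. 86 (the norms `|·|_(α)`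
after (1.55)), p. 77 (plaquette ∕ bond conventions), (1.131) p. 99; [15] = [Balaban1985Variational] (148)–(152) p. 301.  `--kind proof --supports stmt-QuantumFields-20541` (K0⁷;
count-neutral; no definition).
REUSED BY NAME: `B8ScaledSupNorm.{msup, Bdd, weight, norm_le_of_msup_le, weight_neg_natCast}` (p. 86 norms, real `iSup` with EXPLICIT boundedness side condition `Bdd`),
`Node00.CubeB8DZ` + `CubeB8DZ.sq_zero` (dented record tower), `B8Eq191FlatLettersDentedCubeMemberRec.sq_subset_zero` (`Ω′_j ⊆ Ω′₀`, odd `L`),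
`B8Ineq159FlatCubeMemberPerCube.inBox_widen_of_sideTouches`, `B8Eq191FlatLettersCubeMember.inBox_finite`.

THE ANSWER TYPED.  The SU ∕ unitary ∕ G record crowns (`B8Prop6DentedCubeMemberScalarGamma{SURec, SU25Rec, HoldsRec, OfNamedFactsGRec}`) state (152)'s gradient member as the
p. 86 NORM bound `msup L c.k η (−2) (fun j t ↦ SideTouches (c.sq j) t.2.2 t.2.1) (fun t ↦ ∇^η_{t.1} A_{t.2.1}(t.2.2)) ≤ C` (clause 9; member 1, clause 5, is already pointwise).
`msup` is a real `iSup`, so reading it pointwise needs the family to be BOUNDED (`B8ScaledSupNorm.Bdd`; else `iSup = 0` by convention) — and on the dented record tower it IS,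
for ANY family and ANY exponent, because the index set `{(j, t) : j ≤ k, t side-touches Ω′_j}` is FINITE (`Ω′_j ⊆ Ω′₀ = □₀`, a box).  Hence ★ `norm_le_of_msup_sideTouches_sq_le`:
clause 9 ⇒ `‖∇^η_ν A_μ(x)‖ ≤ C·(Lʲη)^{−2}` for every `j ≤ k` and every bond `⟨x, x + e_μ⟩` side-touching `Ω′_j` — member 2 pointwise with the SAME constant `C` as member 1's
numerator, one scale factor lower, as in print.  Nothing else is needed for the push-down.

WHAT IS PROVED (sorry-free).  `sideTouches_sq_triples_finite` (the index set is finite), ★ `bdd_msup_sideTouches_sq` (`Bdd` for every exponent `α` and every family on the dented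
tower), ★ `norm_le_of_msup_sideTouches_sq_le` (norm bound ⇒ pointwise `‖F t‖ ≤ C·(Lʲη)^{α}`), `norm_le_of_msup_sideTouches_sq_le_two` (the `α = −2` reading `C·((Lʲη)²)⁻¹` of
clause 9).  HONEST SCOPE.  Bookkeeping of a supremum over a finite set; NO estimate of Bałaban's; `HThm4Rec` UNDISCHARGED; N05 ∕ N07 NOT discharged; counts unmoved (typed 28∕28 ·
discharged 8∕28); one finite 𝕋⁴ programme at fixed ε, `G = SU(2)` of record — nothing continuum ∕ ℝ⁴ ∕ OS ∕ mass gap ∕ Clay.  No `def`, no `instance`, no `notation`, no `sorry`.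
-/

set_option autoImplicit false

noncomputable section

namespace Literature.MathematicalPhysics.QuantumFieldTheory.Balaban1983to89.B8Prop6DentedCubeMemberNormsPointwiseRec

open B7Prop1Explicit hiding Site
open B7Prop1Explicit renaming Site → SiteZ
open B7Prop1Local
open B8Eq140Level (SideTouches sideTouches_mono)
open B8ScaledSupNorm (weight msup Bdd norm_le_of_msup_le weight_neg_natCast)
open B8Eq131CubesRec (sqLoZ sqHiZ)
open B8Ineq130Rec (tlo thi)
open B8Ineq159FlatCubeMemberPerCube (inBox_widen_of_sideTouches)
open B8Eq191FlatLettersCubeMember (inBox_finite)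
open B8Eq191FlatLettersDentedCubeMemberRec (sq_subset_zero)
open Node00 (CubeB8DZ)

variable {d : ℕ} {L K : ℕ} {Ω : ℕ → Set (SiteZ d)}

/-! ## §1  The index set of clause 9 is finite; the p. 86 family is bounded -/

/-- **The triples `(j, (ν, μ, x))` with `j ≤ k` and `⟨x, x + e_μ⟩` side-touching `Ω′_j` form a FINITE set** (odd `L`): `Ω′_j ⊆ Ω′₀ = □₀` is a box, and a side of a plaquette touching a
box starts in the box widened by `2`. [cite: Balaban1985RegularSpaces, p.77, (1.131) p.99; Balaban1985Variational, (150) p.301] -/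
theorem sideTouches_sq_triples_finite (c : CubeB8DZ d L K Ω) (hLo : Odd L) :
    {q : ℕ × (Fin d × Fin d × SiteZ d) | q.1 ≤ c.k ∧ SideTouches (c.sq q.1) q.2.2.2 q.2.2.1}.Finite := by
  refine (((Finset.range (c.k + 1)).finite_toSet).prod ((Set.finite_univ (α := Fin d)).prod ((Set.finite_univ (α := Fin d)).prod
    (inBox_finite (tlo L (sqLoZ L c.a c.ρ c.k 0) 0 - 2) (thi L (sqHiZ L c.a c.M c.ρ c.k 0) 0 + 1))))).subset ?_
  rintro ⟨j, ν, μ, x⟩ ⟨hj, hs⟩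
  simp only [Set.mem_prod, Finset.coe_range, Set.mem_Iio, Set.mem_setOf_eq, Set.mem_univ, true_and]
  refine ⟨Nat.lt_succ_of_le hj, ?_⟩
  have hsub : c.sq j ⊆ {y | InBox (tlo L (sqLoZ L c.a c.ρ c.k 0) 0) (thi L (sqHiZ L c.a c.M c.ρ c.k 0) 0) y} := by
    intro y hy
    have hy0 : y ∈ c.sq 0 := sq_subset_zero c hLo j hy
    rw [c.sq_zero] at hy0
    exact hy0
  exact inBox_widen_of_sideTouches (sideTouches_mono hsub hs)

variable {E : Type*} [SeminormedAddCommGroup E]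

/-- ★ **On the dented record tower the p. 86 weighted family of clause 9 is BOUNDED, for every exponent `α` and every family `F`** — the side condition `B8ScaledSupNorm.Bdd` of the
real `iSup` (print: finite lattice, tacit), by finiteness of the index set. [cite: Balaban1985RegularSpaces, p.86 (definition after (1.55)); Balaban1985Variational, (150) p.301] -/
theorem bdd_msup_sideTouches_sq (c : CubeB8DZ d L K Ω) (hLo : Odd L) (η α : ℝ) (F : Fin d × Fin d × SiteZ d → E) :
    Bdd L c.k η α (fun j (t : Fin d × Fin d × SiteZ d) => SideTouches (c.sq j) t.2.2 t.2.1) F := by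
  obtain ⟨C, hC⟩ := ((sideTouches_sq_triples_finite c hLo).image
    fun q : ℕ × (Fin d × Fin d × SiteZ d) => weight L η α q.1 * ‖F q.2‖).bddAbove
  refine ⟨C, fun j hj t ht => hC ⟨(j, t), ⟨hj, ht⟩, rfl⟩⟩

/-! ## §2  Print's pointwise form of the crown's gradient clause -/

/-- ★ **THE p. 86 NORM BOUND READ POINTWISE ON THE DENTED RECORD TOWER**: if `sup_{j ≤ k} sup_{t side-touching Ω′_j} (Lʲη)^{−α}‖F t‖ ≤ C` (e.g. clause 9 of `GaugedBoundB8DZ`, `α = −2`,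
`F = ∇^η A`), then `‖F t‖ ≤ C·(Lʲη)^{α}` for every `j ≤ k` and every `t = (ν, μ, x)` with `⟨x, x + e_μ⟩` side-touching `Ω′_j` (`L ≥ 1` odd, `η > 0`) — member 2 of [15] (152) in
print's pointwise shape, exactly as member 1 (clause 5) is displayed. [cite: Balaban1985RegularSpaces, p.86 (definition after (1.55)), (1.41) p.83; Balaban1985Variational, (152) p.301] -/
theorem norm_le_of_msup_sideTouches_sq_le (c : CubeB8DZ d L K Ω) (hLo : Odd L) (hL : 1 ≤ L) {η : ℝ} (hη : 0 < η) {α : ℝ}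
    {F : Fin d × Fin d × SiteZ d → E} {C : ℝ} (h : msup L c.k η α (fun j (t : Fin d × Fin d × SiteZ d) => SideTouches (c.sq j) t.2.2 t.2.1) F ≤ C)
    {j : ℕ} (hj : j ≤ c.k) {t : Fin d × Fin d × SiteZ d} (ht : SideTouches (c.sq j) t.2.2 t.2.1) :
    ‖F t‖ ≤ C * ((L : ℝ) ^ j * η) ^ α :=
  norm_le_of_msup_le hL hη (bdd_msup_sideTouches_sq c hLo η α F) h hj ht

/-- **The `α = −2` reading** (clause 9 of the record crowns): `|∇^η A|_(−2) ≤ C` on the dented tower gives `‖∇^η_ν A_μ(x)‖ ≤ C·((Lʲη)²)⁻¹` on every bond side-touching `Ω′_j`, `j ≤ k`.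
[cite: Balaban1985RegularSpaces, p.86 (definition after (1.55)); Balaban1985Variational, (152) p.301] -/
theorem norm_le_of_msup_sideTouches_sq_le_two (c : CubeB8DZ d L K Ω) (hLo : Odd L) (hL : 1 ≤ L) {η : ℝ} (hη : 0 < η)
    {F : Fin d × Fin d × SiteZ d → E} {C : ℝ} (h : msup L c.k η (-(2 : ℝ)) (fun j (t : Fin d × Fin d × SiteZ d) => SideTouches (c.sq j) t.2.2 t.2.1) F ≤ C)
    {j : ℕ} (hj : j ≤ c.k) {ν μ : Fin d} {x : SiteZ d} (hx : SideTouches (c.sq j) x μ) :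
    ‖F (ν, μ, x)‖ ≤ C * (((L : ℝ) ^ j * η) ^ 2)⁻¹ := by
  have h1 := norm_le_of_msup_sideTouches_sq_le c hLo hL hη h hj (t := (ν, μ, x)) hx
  have hs : 0 < (L : ℝ) ^ j * η := by
    have : (0 : ℝ) < (L : ℝ) ^ j := by positivity
    positivity
  have e2 : ((L : ℝ) ^ j * η) ^ (-(2 : ℝ)) = (((L : ℝ) ^ j * η) ^ 2)⁻¹ := by
    rw [Real.rpow_neg hs.le, show (2 : ℝ) = ((2 : ℕ) : ℝ) by norm_num, Real.rpow_natCast]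
  rw [e2] at h1
  exact h1

end Literature.MathematicalPhysics.QuantumFieldTheory.Balaban1983to89.B8Prop6DentedCubeMemberNormsPointwiseRec
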